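import Summits.ResolutionOfSingularities.ResolutionOfSingularities.Theorems.HilbertStallClasses
import HarnessLib

/-!
# HilbertStall — the DECIDED half: a stall produces an isolation certificate of explicit size

Node «HilbertStall» (decomp-res lens-3, g31), the NEW MECHANISM: the determinant trick of Cayley–Hamilton / Nakayama
(AtiyahMacdonald1969 Prop. 2.4, Cor. 2.5) made EFFECTIVE over `MvPolynomial σ K`, with explicit degree bookkeeping.

Given generators `f i` (`i : τ`, a `Fintype`) of total degree `≤ D` of an ideal `J` whose Hilbert–Samuel function STALLS
at index `k` (`𝔪^k ≤ J + 𝔪^(k+1)`), for every exponent `b` of degree `k` one has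
`x^b = Σ_i u_{b,i} f_i + r_b` with `r_b ∈ 𝔪^(k+1)`; truncating the cofactors at degree `k` leaves a DEFECT
`v_b := x^b − Σ_i low_k(u_{b,i}) f_i ∈ 𝔪^(k+1)` of degree `≤ k + D`, which is rewritten over the degree-`k` monomials as
`v_b = Σ_{b'} E_{b b'} x^{b'}` with `E_{b b'} ∈ 𝔪` of degree `≤ D` (each exponent `c` of `v_b` is filed under its FLOOR
`b' = floor_k c ≤ c`).  With `A := 1 − E` (a `μ_k × μ_k` matrix over `K[x]`, `μ_k = #mons σ k`):
`A *ᵥ X = U · f`, hence `det A • X = adj A *ᵥ (U · f)` (`Matrix.adjugate_mul`), i.e. `g := det A` satisfies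
`g(0) = det 1 = 1` and `g · x^{b₀} ∈ J` for every degree-`k` exponent `b₀`, with cofactors `Σ_b adj_{b₀ b} · low_k(u_{b,i})`;
sizes: `N = k`, `deg g ≤ μ_k · D`, cofactor degree `≤ μ_k · D + k`.

Main results: `totalDegree_det_le`, `cert_of_idealStall` (general ideals), and the door-side LAW
`isolatedTopCert_of_stall : F.totalDegree ≤ D → Stall q F k → IsolatedTopCert q (stallSize σ k D) F`
(hypothesis-free, every field and characteristic).
-/

set_option linter.dupNamespace false

noncomputable section

open MvPolynomial
open Literature.AlgebraicGeometry.Resolution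
open Summit.ResolutionOfSingularities.ResolutionOfSingularities.Theorems.TightDefectClasses
open Summit.ResolutionOfSingularities.ResolutionOfSingularities.Theorems.UltraWalk

namespace Summit.ResolutionOfSingularities.ResolutionOfSingularities.Theorems.HilbertStall

/-! ## §1 Degrees of determinants and adjugates over `MvPolynomial` -/

section Det

variable {σ : Type} {K : Type} [CommRing K] {n : Type} [DecidableEq n] [Fintype n]

/-- A determinant of polynomials of degree `≤ D` has degree `≤ card n · D`. [folklore] -/
theorem totalDegree_det_le (M : Matrix n n (MvPolynomial σ K)) {D : ℕ} (hM : ∀ i j, (M i j).totalDegree ≤ D) :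
    M.det.totalDegree ≤ Fintype.card n * D := by
  rw [Matrix.det_apply]
  refine totalDegree_finsetSum_le fun τ _ => ?_
  have hprod : (∏ i, M (τ i) i).totalDegree ≤ Fintype.card n * D :=
    (totalDegree_finsetProd _ _).trans (by
      calc ∑ i, (M (τ i) i).totalDegree ≤ ∑ _i : n, D := Finset.sum_le_sum fun i _ => hM _ _
        _ = Fintype.card n * D := by rw [Finset.sum_const, smul_eq_mul, Finset.card_univ])
  rcases Int.units_eq_one_or (Equiv.Perm.sign τ) with h | h
  · rw [h, one_smul]; exact hprod
  · rw [h, Units.neg_smul, one_smul, totalDegree_neg]; exact hprod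

/-- An adjugate entry of a matrix of polynomials of degree `≤ D` has degree `≤ card n · D`. [folklore] -/
theorem totalDegree_adjugate_le (M : Matrix n n (MvPolynomial σ K)) {D : ℕ} (hM : ∀ i j, (M i j).totalDegree ≤ D)
    (i j : n) : (M.adjugate i j).totalDegree ≤ Fintype.card n * D := by
  rw [Matrix.adjugate_apply]
  refine totalDegree_det_le _ fun a b => ?_
  rw [Matrix.updateRow_apply]
  split_ifs with h
  · rw [Pi.single_apply]
    split_ifs
    · rw [totalDegree_one]; exact Nat.zero_le D
    · rw [totalDegree_zero]; exact Nat.zero_le D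
  · exact hM a b

/-- The constant coefficient of a determinant is the determinant of the constant coefficients. [folklore] -/
theorem constantCoeff_det (M : Matrix n n (MvPolynomial σ K)) :
    constantCoeff M.det = (M.map (constantCoeff : MvPolynomial σ K →+* K)).det := by
  rw [RingHom.map_det, RingHom.mapMatrix_apply]

end Det

/-! ## §2 The determinant trick, effective -/

section Trick

variable {σ : Type} [DecidableEq σ] [Fintype σ] {K : Type} [CommRing K] {τ : Type} [Fintype τ]

omit [DecidableEq σ] [Fintype σ] in
/-- STALL DATA: under a stall at `k`, every degree-`k` monomial is a combination of the generators up to `𝔪^(k+1)`.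
[folklore] -/
theorem exists_cofactors_of_idealStall (f : τ → MvPolynomial σ K) {k : ℕ}
    (hst : IdealStall (Ideal.span (Set.range f)) k) {b : σ →₀ ℕ} (hb : b.degree = k) :
    ∃ u : τ → MvPolynomial σ K, monomial b 1 - ∑ i, u i * f i ∈ idealOfVars σ K ^ (k + 1) := by
  have hmem : monomial b (1 : K) ∈ Ideal.span (Set.range f) ⊔ idealOfVars σ K ^ (k + 1) :=
    hst (monomial_mem_pow_of_le hb.ge 1)
  obtain ⟨j, hj, r, hr, hjr⟩ := Submodule.mem_sup.mp hmem
  obtain ⟨u, hu⟩ := (Submodule.mem_span_range_iff_exists_fun (MvPolynomial σ K)).mp hj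
  refine ⟨u, ?_⟩
  simp only [smul_eq_mul] at hu
  rw [hu, ← hjr, add_sub_cancel_left]
  exact hr

variable (f : τ → MvPolynomial σ K) {k : ℕ} (hst : IdealStall (Ideal.span (Set.range f)) k)

/-- The chosen COFACTORS `u_{b,i}` of a degree-`k` exponent `b`. DEFINITION (support). [folklore] -/
def cof (b : ↥(mons σ k)) : τ → MvPolynomial σ K :=
  (exists_cofactors_of_idealStall f hst (mem_mons_iff.mp b.2)).choose

/-- Specification of the cofactors. [folklore] -/
theorem cof_spec (b : ↥(mons σ k)) :
    monomial (b : σ →₀ ℕ) 1 - ∑ i, cof f hst b i * f i ∈ idealOfVars σ K ^ (k + 1) :=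
  (exists_cofactors_of_idealStall f hst (mem_mons_iff.mp b.2)).choose_spec

/-- The DEFECT `v_b := x^b − Σ_i low_k(u_{b,i}) · f_i` after truncating the cofactors at degree `k`.
DEFINITION (support). [folklore] -/
def defect (b : ↥(mons σ k)) : MvPolynomial σ K :=
  monomial (b : σ →₀ ℕ) 1 - ∑ i, lowPart k (cof f hst b i) * f i

/-- The defect lies in `𝔪^(k+1)`. [folklore] -/
theorem defect_mem (b : ↥(mons σ k)) : defect f hst b ∈ idealOfVars σ K ^ (k + 1) := by
  have h : defect f hst b = (monomial (b : σ →₀ ℕ) 1 - ∑ i, cof f hst b i * f i)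
      + ∑ i, (cof f hst b i - lowPart k (cof f hst b i)) * f i := by
    simp only [defect, sub_mul, Finset.sum_sub_distrib]; ring
  rw [h]
  exact add_mem (cof_spec f hst b) (sum_mem fun i _ => Ideal.mul_mem_right _ _ (sub_lowPart_mem_pow k _))

/-- The defect has degree `≤ k + D`. [folklore] -/
theorem totalDegree_defect_le {D : ℕ} (hf : ∀ i, (f i).totalDegree ≤ D) (b : ↥(mons σ k)) :
    (defect f hst b).totalDegree ≤ k + D := by
  rw [defect]
  refine (totalDegree_sub _ _).trans (max_le ?_ ?_)
  · refine (totalDegree_monomial_le _ _).trans ?_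
    have e : ((b : σ →₀ ℕ).sum fun _ => id) = (b : σ →₀ ℕ).degree := by simp [Finsupp.sum, Finsupp.degree_apply]
    rw [e, mem_mons_iff.mp b.2]; exact Nat.le_add_right k D
  · refine totalDegree_finsetSum_le fun i _ => (totalDegree_mul _ _).trans ?_
    exact add_le_add (totalDegree_lowPart_le k _) (hf i)

/-- Every exponent of the defect has degree in `[k+1, k+D]`. [folklore] -/
theorem degree_bounds_of_mem_support_defect {D : ℕ} (hf : ∀ i, (f i).totalDegree ≤ D) (b : ↥(mons σ k))
    {c : σ →₀ ℕ} (hc : c ∈ (defect f hst b).support) : k + 1 ≤ c.degree ∧ c.degree ≤ k + D := by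
  refine ⟨(mem_pow_idealOfVars_iff _ _).mp (defect_mem f hst b) c hc, ?_⟩
  have h := le_totalDegree hc
  have e : (c.sum fun _ e => e) = c.degree := by simp [Finsupp.sum, Finsupp.degree_apply]
  rw [e] at h
  exact h.trans (totalDegree_defect_le f hst hf b)

/-- The MATRIX ENTRY `E_{b m} := Σ_{c : floor_k c = m} coeff_c(v_b) · x^{c − m}` (the part of the defect filed under the
degree-`k` exponent `m`). DEFINITION (support). [folklore] -/
def entry (b : ↥(mons σ k)) (m : σ →₀ ℕ) : MvPolynomial σ K :=
  ∑ c ∈ (defect f hst b).support with floor k c = m, monomial (c - m) (coeff c (defect f hst b))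

/-- The entries have vanishing constant coefficient (`E_{b m} ∈ 𝔪`). [folklore] -/
theorem constantCoeff_entry {D : ℕ} (hf : ∀ i, (f i).totalDegree ≤ D) (b : ↥(mons σ k)) (m : σ →₀ ℕ) :
    constantCoeff (entry f hst b m) = 0 := by
  rw [entry, map_sum]
  refine Finset.sum_eq_zero fun c hc => ?_
  rw [Finset.mem_filter] at hc
  rw [constantCoeff_monomial, if_neg]
  intro h0
  have hk : k ≤ c.degree := (Nat.le_succ k).trans (degree_bounds_of_mem_support_defect f hst hf b hc.1).1
  have h1 := degree_sub_floor hk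
  rw [hc.2, h0, map_zero, zero_add] at h1
  have h2 := (degree_bounds_of_mem_support_defect f hst hf b hc.1).1
  omega

/-- The entries have degree `≤ D`. [folklore] -/
theorem totalDegree_entry_le {D : ℕ} (hf : ∀ i, (f i).totalDegree ≤ D) (b : ↥(mons σ k)) (m : σ →₀ ℕ) :
    (entry f hst b m).totalDegree ≤ D := by
  rw [entry]
  refine totalDegree_finsetSum_le fun c hc => (totalDegree_monomial_le _ _).trans ?_
  rw [Finset.mem_filter] at hc
  have e : ((c - m).sum fun _ => id) = (c - m).degree := by simp [Finsupp.sum, Finsupp.degree_apply]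
  rw [e]
  have hb := degree_bounds_of_mem_support_defect f hst hf b hc.1
  have hk : k ≤ c.degree := (Nat.le_succ k).trans hb.1
  have h1 := degree_sub_floor hk
  rw [hc.2] at h1
  omega

/-- ROW IDENTITY of the entries: `Σ_{m ∈ mons} E_{b m} · x^m = v_b`. [folklore] -/
theorem sum_entry_mul_monomial {D : ℕ} (hf : ∀ i, (f i).totalDegree ≤ D) (b : ↥(mons σ k)) :
    ∑ m ∈ mons σ k, entry f hst b m * monomial m 1 = defect f hst b := by
  have hmaps : ∀ c ∈ (defect f hst b).support, floor k c ∈ mons σ k := fun c hc =>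
    floor_mem_mons ((Nat.le_succ k).trans (degree_bounds_of_mem_support_defect f hst hf b hc).1)
  have hinner : ∀ m ∈ mons σ k, entry f hst b m * monomial m 1 =
      ∑ c ∈ (defect f hst b).support with floor k c = m, monomial c (coeff c (defect f hst b)) := by
    intro m _
    rw [entry, Finset.sum_mul]
    refine Finset.sum_congr rfl fun c hc => ?_
    rw [Finset.mem_filter] at hc
    have hk : k ≤ c.degree := (Nat.le_succ k).trans (degree_bounds_of_mem_support_defect f hst hf b hc.1).1
    rw [monomial_mul, mul_one, ← hc.2, tsub_add_cancel_of_le (floor_le hk)]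
  rw [Finset.sum_congr rfl hinner, Finset.sum_fiberwise_of_maps_to hmaps]
  exact (as_sum _).symm

/-- The MATRIX `A := 1 − E` of the determinant trick (indexed by the degree-`k` exponents). DEFINITION (support).
[folklore] -/
def trickMatrix : Matrix ↥(mons σ k) ↥(mons σ k) (MvPolynomial σ K) :=
  (1 : Matrix ↥(mons σ k) ↥(mons σ k) (MvPolynomial σ K)) - Matrix.of fun b b' : ↥(mons σ k) => entry f hst b b'.1

/-- The column of degree-`k` monomials. DEFINITION (support). [folklore] -/
def monVec : ↥(mons σ k) → MvPolynomial σ K := fun b => monomial (b : σ →₀ ℕ) 1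

/-- `A *ᵥ X = U · f`: the rows of `A` applied to the monomial column are combinations of the generators with the
TRUNCATED cofactors. [folklore] -/
theorem trickMatrix_mulVec {D : ℕ} (hf : ∀ i, (f i).totalDegree ≤ D) :
    (trickMatrix f hst).mulVec (monVec (σ := σ) (K := K) (k := k)) = fun b => ∑ i, lowPart k (cof f hst b i) * f i := by
  funext b
  rw [trickMatrix, Matrix.sub_mulVec, Matrix.one_mulVec, Pi.sub_apply]
  have hE : (Matrix.of fun b b' : ↥(mons σ k) => entry f hst b b'.1).mulVec (monVec (k := k)) b
      = defect f hst b := by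
    simp only [Matrix.mulVec, dotProduct, Matrix.of_apply, monVec]
    rw [Finset.sum_coe_sort (mons σ k) (fun m => entry f hst b m * monomial m 1)]
    exact sum_entry_mul_monomial f hst hf b
  rw [hE, monVec, defect, sub_sub_cancel]

/-- The entries of `A` have degree `≤ D`. [folklore] -/
theorem totalDegree_trickMatrix_le {D : ℕ} (hf : ∀ i, (f i).totalDegree ≤ D) (b b' : ↥(mons σ k)) :
    (trickMatrix f hst b b').totalDegree ≤ D := by
  rw [trickMatrix, Matrix.sub_apply, Matrix.one_apply, Matrix.of_apply]
  refine (totalDegree_sub _ _).trans (max_le ?_ (totalDegree_entry_le f hst hf b _))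
  split_ifs
  · rw [totalDegree_one]; exact Nat.zero_le D
  · rw [totalDegree_zero]; exact Nat.zero_le D

/-- `g := det A` has constant coefficient `1` (`E ∈ 𝔪` entrywise, so `A ≡ 1 mod 𝔪`). [folklore] -/
theorem constantCoeff_det_trickMatrix {D : ℕ} (hf : ∀ i, (f i).totalDegree ≤ D) :
    constantCoeff (trickMatrix f hst).det = 1 := by
  rw [constantCoeff_det]
  have h1 : (trickMatrix f hst).map (constantCoeff : MvPolynomial σ K →+* K) = 1 := by
    ext b b'
    rw [Matrix.map_apply, trickMatrix, Matrix.sub_apply, Matrix.one_apply, Matrix.of_apply, map_sub,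
      constantCoeff_entry f hst hf, sub_zero, Matrix.one_apply]
    split_ifs
    · exact map_one _
    · exact map_zero _
  rw [h1, Matrix.det_one]

/-- **THE DETERMINANT TRICK, EFFECTIVE.**  Generators of degree `≤ D` of an ideal stalling at index `k` admit
`g` with `g(0) = 1`, `deg g ≤ μ_k · D`, and cofactors of degree `≤ μ_k · D + k` with `g · x_l^k = Σ_i H_{l,i} f_i` for
every variable.  (AtiyahMacdonald1969 Prop. 2.4 / Cor. 2.5 with degree bookkeeping.) [folklore] -/
theorem cert_of_idealStall {D : ℕ} (hf : ∀ i, (f i).totalDegree ≤ D)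
    (hst : IdealStall (Ideal.span (Set.range f)) k) :
    ∃ (g : MvPolynomial σ K) (H : σ → τ → MvPolynomial σ K), constantCoeff g = 1 ∧
      g.totalDegree ≤ (mons σ k).card * D ∧ (∀ l i, (H l i).totalDegree ≤ (mons σ k).card * D + k) ∧
      ∀ l, g * X l ^ k = ∑ i, H l i * f i := by
  set A := trickMatrix f hst with hA
  have hcard : Fintype.card ↥(mons σ k) = (mons σ k).card := Fintype.card_coe _
  have hvec : A.det • monVec (σ := σ) (K := K) (k := k)
      = A.adjugate.mulVec (fun b => ∑ i, lowPart k (cof f hst b i) * f i) := by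
    rw [← trickMatrix_mulVec f hst hf, Matrix.mulVec_mulVec, Matrix.adjugate_mul, Matrix.smul_mulVec,
      Matrix.one_mulVec]
  refine ⟨A.det, fun l i => ∑ b, A.adjugate ⟨Finsupp.single l k, single_mem_mons l k⟩ b * lowPart k (cof f hst b i),
    constantCoeff_det_trickMatrix f hst hf, ?_, fun l i => ?_, fun l => ?_⟩
  · rw [← hcard]; exact totalDegree_det_le A (totalDegree_trickMatrix_le f hst hf)
  · refine totalDegree_finsetSum_le fun b _ => (totalDegree_mul _ _).trans (add_le_add ?_ (totalDegree_lowPart_le k _))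
    rw [← hcard]; exact totalDegree_adjugate_le A (totalDegree_trickMatrix_le f hst hf) _ _
  · have h := congrFun hvec ⟨Finsupp.single l k, single_mem_mons l k⟩
    simp only [Pi.smul_apply, smul_eq_mul, monVec, Matrix.mulVec, dotProduct] at h
    rw [X_pow_eq_monomial, h]
    simp_rw [Finset.mul_sum]
    rw [Finset.sum_comm]
    refine Finset.sum_congr rfl fun i _ => ?_
    rw [Finset.sum_mul]
    refine Finset.sum_congr rfl fun b _ => ?_
    ring

end Trick

/-! ## §3 The door-side LAW: a stall of the top ideal gives a certificate of explicit size -/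

section Law

variable {σ : Type} [DecidableEq σ] [Fintype σ] {K : Type} [Field K]

/-- **LAW (hypothesis-free, every field): `Stall q F k` with `deg F ≤ D` gives `IsolatedTopCert q (μ_k · D + k) F`.**
This is the DECIDED half of the node «HilbertStall»: the door `BoundedIsolation` restricted to the class of tops stalling
at a given index holds with an explicit bound, uniformly in the field. [folklore] -/
theorem isolatedTopCert_of_stall {q k D : ℕ} {F : MvPolynomial σ K} (hF : F.totalDegree ≤ D) (hs : Stall q F k) :
    IsolatedTopCert q (stallSize σ k D) F := by
  have hst : IdealStall (Ideal.span (Set.range fun a : ↥(hasseIndex σ q) => hasseDeriv K (a : σ →₀ ℕ) F)) k := by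
    have h := hs; rwa [Stall, topIdeal_eq_span_range] at h
  have hf : ∀ a : ↥(hasseIndex σ q), (hasseDeriv K (a : σ →₀ ℕ) F).totalDegree ≤ D := fun a =>
    totalDegree_hasseDeriv_le_of_le hF
  obtain ⟨g, H, hg1, hgdeg, hHdeg, heq⟩ := cert_of_idealStall _ hf hst
  refine ⟨⟨k, Nat.le_add_left k _, g, hgdeg.trans (Nat.le_add_right _ k), ?_,
    fun l a => if ha : a ∈ hasseIndex σ q then H l ⟨a, ha⟩ else 0, fun l a => ?_, fun l => ?_⟩⟩
  · rw [← constantCoeff_eq, hg1]; exact one_ne_zero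
  · split_ifs with ha
    · exact hHdeg l ⟨a, ha⟩
    · rw [totalDegree_zero]; exact Nat.zero_le _
  · rw [heq l, ← Finset.sum_coe_sort (hasseIndex σ q)]
    refine Finset.sum_congr rfl fun a _ => ?_
    rw [dif_pos a.2]

/-- Packaged: every stall level `L` is a sub-class of the door on which `BoundedIsolation` HOLDS with the explicit
`β = stallSize σ L D`. [folklore] -/
theorem boundedIsolation_on_stall_class (q D L : ℕ) :
    ∀ (K : Type) [Field K] (F : MvPolynomial (Fin 3) K), F.totalDegree ≤ D → Stall q F L →
      IsolatedTopCert q (stallSize (Fin 3) L D) F :=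
  fun _ _ _ hF hs => isolatedTopCert_of_stall hF hs

end Law

end Summit.ResolutionOfSingularities.ResolutionOfSingularities.Theorems.HilbertStall

end
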